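import Literature.Computability.AlgebraicComplexity.BorderRankMatMulSmall
import Literature.Computability.AlgebraicComplexity.LandsbergMichalekSubstitution
import Literature.Computability.AlgebraicComplexity.CoppersmithWinograd1982Crude
import HarnessLib

/-!
# Landsberg–Michałek 2018, Theorem 1.1 — proved (`LandsbergMichalek2018_thm_1_1_holds`)

Topic `Literature/Computability/AlgebraicComplexity`. Sibling proof file of `BorderRankMatMulSmall.lean`
(next to `BorderRankMatMulSmallProofs.lean`, which holds the Smirnov 2013 certificate for `⟨2,3,3⟩`):
it discharges the named fact `LandsbergMichalek2018_thm_1_1`,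

  `0 < m < n`, `w ≥ 1` ⟹ `R̲(⟨n,n,w⟩) ≥ 2nw − w + m − ⌊w C(n−1+m, m−1) / C(2n−2, n−1)⌋` over `ℂ`

(J. M. Landsberg, M. Michałek, IMRN 2018, Thm. 1.1), for the tree's algebraic border rank
`algBorderRank` of `matMulTensor ℂ n n w`, sorry-free, following the printed proof (LM18 §3):

* `R̲(⟨n,n,w⟩) = R̲(⟨n,w,n⟩)` (`algBorderRank_matMulTensor_rotate`), so that the `n × n` factor on which
  LM18 substitute and flatten is the first one;
* **Part 1** (`LandsbergMichalekSubstitution.lean`, border substitution + Borel/torus normalisation):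
  a Young diagram `λ` with `m` cells and `R̲(⟨n,w,n⟩^λ) + m ≤ R̲(⟨n,w,n⟩)`
  (`exists_isLowerSet_algBorderRank_add_le`);
* **Part 2** (`LandsbergMichalekKoszul.lean`, triangularity of the reduced Koszul flattening, LM16 §6,
  and the binomial optimisation of `LandsbergMichalekBinomial.lean`):
  `w ((2n−1) C(2n−2,n−1) − C(n−1+m,m−1)) ≤ C(2n−2,n−1) · R̲(⟨n,w,n⟩^λ)`
  (`LandsbergMichalek2018_partTwo_young`);
* the arithmetic `(2n−1) w − R̲(⟨n,w,n⟩^λ) ≤ ⌊w C(n−1+m,m−1)/C(2n−2,n−1)⌋`.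

The headline bound `R̲(⟨n,n,n⟩) ≥ 2n² − ⌈log₂ n⌉ − 1` then follows by the glue already in
`BorderRankMatMulSmall.lean` (`LandsbergMichalek2018_borderRank_matMulTensor_of_thm_1_1`).

## References

* J. M. Landsberg, M. Michałek, *A `2n² − log₂(n) − 1` lower bound for the border rank of matrix
  multiplication*, IMRN 2018 (15) 4722–4733 = arXiv:1608.07486 (held: paper:arxiv-1608.07486):
  Thm. 1.1 (chunk 3), proof §3 (chunks 5–6). [LandsbergMichalek2018]
-/

noncomputable section

open scoped BigOperators

namespace Literature.Computability.AlgebraicComplexity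

/-! ## Landsberg–Michałek 2018, Theorem 1.1 -/

section Final

/-- **Landsberg–Michałek 2018, Theorem 1.1** (discharge of the named fact
`LandsbergMichalek2018_thm_1_1`): for `0 < m < n` and `w ≥ 1`,
`R̲(⟨n,n,w⟩) ≥ 2nw − w + m − ⌊w C(n−1+m, m−1) / C(2n−2, n−1)⌋` over `ℂ`.
Proof as in LM18 §3: `R̲(⟨n,n,w⟩) = R̲(⟨n,w,n⟩)`; Part 1 gives a Young diagram `λ` with `m` cells and
`R̲(⟨n,w,n⟩^λ) + m ≤ R̲(⟨n,w,n⟩)` (`exists_isLowerSet_algBorderRank_add_le`); Part 2 gives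
`w((2n−1) C(2n−2,n−1) − C(n−1+m,m−1)) ≤ C(2n−2,n−1) R̲(⟨n,w,n⟩^λ)`
(`LandsbergMichalek2018_partTwo_young`). [cite: LandsbergMichalek2018, Thm. 1.1] -/
theorem LandsbergMichalek2018_thm_1_1_holds : LandsbergMichalek2018_thm_1_1 := by
  intro n m w hm hmn hw
  obtain ⟨p, rfl⟩ : ∃ p, n = p + 1 := ⟨n - 1, by omega⟩
  -- normalise the statement: `⟨n,n,w⟩ ↦ ⟨n,w,n⟩`, `n - 1 = p`, `2n - 2 = 2p`
  rw [algBorderRank_matMulTensor_rotate ℂ (p + 1) (p + 1) w]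
  have e1 : p + 1 - 1 + m = p + m := by omega
  have e2 : 2 * (p + 1) - 2 = 2 * p := by omega
  have e3 : p + 1 - 1 = p := by omega
  have e4 : 2 * (p + 1) * w - w + m = (2 * p + 1) * w + m := by
    rw [show 2 * (p + 1) * w = (2 * p + 1) * w + w by ring]
    omega
  rw [e1, e2, e3, e4]
  -- Part 1
  obtain ⟨D, hD, hcard, h1⟩ := exists_isLowerSet_algBorderRank_add_le (K := ℂ) (n := p + 1) hw m
    (by nlinarith)
  -- Part 2
  have h2 := LandsbergMichalek2018_partTwo_young ℂ p w m D hD hcard hm (by omega)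
  set B := algBorderRank (delSlices D (matMulTensor ℂ (p + 1) w (p + 1))) with hB
  set Cc := (2 * p).choose p with hCc
  set Q := (p + m).choose (m - 1) with hQ
  have hCpos : 0 < Cc := Nat.choose_pos (by omega)
  -- `(2p+1) w ≤ B + ⌊w Q / Cc⌋`
  obtain ⟨q, hq⟩ : ∃ q, w * Q / Cc = q := ⟨_, rfl⟩
  rw [hq]
  have hkey : (2 * p + 1) * w ≤ B + q := by
    rcases le_or_gt B ((2 * p + 1) * w) with hBle | hBgt
    · obtain ⟨d, hd⟩ := Nat.exists_eq_add_of_le hBle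
      have h5 : d * Cc ≤ w * Q := by
        have e5 : w * ((2 * p + 1) * Cc) = B * Cc + d * Cc := by
          rw [show w * ((2 * p + 1) * Cc) = ((2 * p + 1) * w) * Cc by ring, hd]; ring
        rw [e5] at h2
        nlinarith
      have h6 : d ≤ q := hq ▸ (Nat.le_div_iff_mul_le hCpos).2 h5
      omega
    · omega
  omega

end Final

/-- **The headline bound of Landsberg–Michałek 2018, unconditionally**: for every `n ≥ 1`,
`2n² ≤ R̲(⟨n,n,n⟩) + ⌈log₂ n⌉ + 1` over `ℂ` (the named fact
`LandsbergMichalek2018_borderRank_matMulTensor`, discharged from Thm. 1.1 by the glue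
`LandsbergMichalek2018_borderRank_matMulTensor_of_thm_1_1`). [cite: LandsbergMichalek2018, Thm. 1.1] -/
theorem LandsbergMichalek2018_borderRank_matMulTensor_holds :
    LandsbergMichalek2018_borderRank_matMulTensor :=
  LandsbergMichalek2018_borderRank_matMulTensor_of_thm_1_1 LandsbergMichalek2018_thm_1_1_holds

end Literature.Computability.AlgebraicComplexity

end
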